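import Summits.Ventures.PercRepro.SixFourResidueTwoClauses

/-!
# PercRepro — C-025 at `(6,4)`: the big-plane clause (Theorem 22′ beyond Theorem 22) in its three pieces (p3, gen 11)

`BigPlaneClause` (`SixFourResidueClauses.lean`) — the type-`4` half of `SixFourResidue` left open by Theorem 22
(`J_four_nonneg_of_ten_le`: `0 ≤ J₄` when every plane trace has `≤ 7` points) — asks for `0 ≤ J₄(G)` on every
rank-`4` set `G ⊆ E` of a simple matroid with `g ≥ 10` points and a plane trace of `≥ 8` points.  Mine-2's §21.17 /
§21.18.5 prove Theorem 22′ (`TwentyTwoPrime`: `0 ≤ J₄` for EVERY such `G` with `g ≥ 10`, no plane cap) by the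
trichotomy of §21.18.1 — exactly the case split of p2's `J_four_nonneg_of_card_le_nine` at `g ≤ 9`:
* (α) `GenericFour` — **Theorem G (§21.13, no plane cap)**: `0 ≤ J₄` for every generic `G` (`Generic M G`: no plane
  trace has a complement of rank `≤ 2`) with `g ≥ 10`; its honest residue beyond Theorem 22 is `GenericFourBig`
  (a plane trace of `≥ 8` points), and the two are equivalent in the tree (`genericFour_iff_big`);
* (β) `PlaneAddTwoFour` — **Theorem 21.6 at `t = 4` for every size**: `0 ≤ J₄` when some plane trace has `g − 2`
  points and `g ≥ 10` (the rank-`3` profile inequality `Δ₄(τ) ≥ 0`, §21.18.3; p2's `J_four_nonneg_of_plane_add_two`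
  is its `g ≤ 9` case; «plane + one point» is `J_four_nonneg_of_plane_add_one`, vacuous at `t = 4`, no size cap);
* (γ) `PlaneLineFour` — **the plane-line branch of Theorem 22′ (c) / §21.18.7**: `0 ≤ J₄` for every non-generic `G`
  with `g ≥ 10` all of whose plane traces have `≤ g − 3` points (the coarse lists for `g ≤ 12`, the termwise table
  TW-100 for `13 ≤ g ≤ 100`, the two-regime tail TW-∞ for `g ≥ 101`); its honest residue beyond Theorem 22 is
  `PlaneLineFourBig` (a plane trace of `≥ 8` points), equivalent in the tree (`planeLineFour_iff_big`).
The compositions are **`bigPlaneClause_of : GenericFourBig → PlaneAddTwoFour → PlaneLineFourBig → BigPlaneClause`**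
and **`twentyTwoPrime_of : GenericFour → PlaneAddTwoFour → PlaneLineFour → TwentyTwoPrime`**; with
`sixFourResidue_of_two_clauses` the residue of C-025 at `(6,4)` then reads
`TypeThreeClause ∧ GenericFourBig ∧ PlaneAddTwoFour ∧ PlaneLineFourBig` (`sixFourResidue_of_big_pieces`).
Nothing here is proved about the pieces themselves: this file fixes their statements in the tree's vocabulary.
-/

namespace PercRepro.SixFour

open Finset ThmH PerFlat ThmN

/-- **Theorem G (§21.13, no plane cap) at `t = 4`, `g ≥ 10`**: `0 ≤ J₄(G)` for every generic rank-`4` set `G ⊆ E`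
of a simple matroid with at least `10` points. -/
def GenericFour : Prop :=
  ∀ {β : Type} [DecidableEq β] (M : Matroid β) [M.Finite] (G : Finset β), Simple M → G ⊆ gr M →
    M.eRk (G : Set β) = 4 → Generic M G → 10 ≤ G.card → 0 ≤ J M G 4

/-- **Theorem G beyond Theorem 22**: `0 ≤ J₄(G)` for every generic rank-`4` set `G ⊆ E` of a simple matroid with at
least `10` points and a plane trace of at least `8` points. -/
def GenericFourBig : Prop :=
  ∀ {β : Type} [DecidableEq β] (M : Matroid β) [M.Finite] (G : Finset β), Simple M → G ⊆ gr M →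
    M.eRk (G : Set β) = 4 → Generic M G → 10 ≤ G.card → (∃ P ∈ planes M, 8 ≤ (P ∩ G).card) → 0 ≤ J M G 4

/-- **Theorem 21.6 at `t = 4`, every size**: `0 ≤ J₄(G)` for every rank-`4` set `G ⊆ E` of a simple matroid with at
least `10` points and a plane trace of exactly `g − 2` points. -/
def PlaneAddTwoFour : Prop :=
  ∀ {β : Type} [DecidableEq β] (M : Matroid β) [M.Finite] (G : Finset β), Simple M → G ⊆ gr M →
    M.eRk (G : Set β) = 4 → ∀ P ∈ planes M, (P ∩ G).card + 2 = G.card → 10 ≤ G.card → 0 ≤ J M G 4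

/-- **The plane-line branch of Theorem 22′ (§21.17 (c) / §21.18.7)**: `0 ≤ J₄(G)` for every non-generic rank-`4`
set `G ⊆ E` of a simple matroid with at least `10` points all of whose plane traces have at most `g − 3` points. -/
def PlaneLineFour : Prop :=
  ∀ {β : Type} [DecidableEq β] (M : Matroid β) [M.Finite] (G : Finset β), Simple M → G ⊆ gr M →
    M.eRk (G : Set β) = 4 → ¬ Generic M G → (∀ P ∈ planes M, (P ∩ G).card + 3 ≤ G.card) → 10 ≤ G.card →
    0 ≤ J M G 4

/-- **The plane-line branch beyond Theorem 22**: as `PlaneLineFour`, with a plane trace of at least `8` points. -/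
def PlaneLineFourBig : Prop :=
  ∀ {β : Type} [DecidableEq β] (M : Matroid β) [M.Finite] (G : Finset β), Simple M → G ⊆ gr M →
    M.eRk (G : Set β) = 4 → ¬ Generic M G → (∀ P ∈ planes M, (P ∩ G).card + 3 ≤ G.card) → 10 ≤ G.card →
    (∃ P ∈ planes M, 8 ≤ (P ∩ G).card) → 0 ≤ J M G 4

/-- Theorem G is exactly its big-plane residue plus Theorem 22 (`J_four_nonneg_of_ten_le`). -/
theorem genericFour_iff_big : GenericFour ↔ GenericFourBig := by
  constructor
  · intro h β _ M _ G hs hG hr hgen hg _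
    exact h M G hs hG hr hgen hg
  · intro h β _ M _ G hs hG hr hgen hg
    by_cases hbig : ∃ P ∈ planes M, 8 ≤ (P ∩ G).card
    · exact h M G hs hG hr hgen hg hbig
    · push Not at hbig
      exact J_four_nonneg_of_ten_le hs hG hr (fun P hP => by have := hbig P hP; omega) hg

/-- The plane-line branch is exactly its big-plane residue plus Theorem 22 (`J_four_nonneg_of_ten_le`). -/
theorem planeLineFour_iff_big : PlaneLineFour ↔ PlaneLineFourBig := by
  constructor
  · intro h β _ M _ G hs hG hr hng hpl hg _
    exact h M G hs hG hr hng hpl hg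
  · intro h β _ M _ G hs hG hr hng hpl hg
    by_cases hbig : ∃ P ∈ planes M, 8 ≤ (P ∩ G).card
    · exact h M G hs hG hr hng hpl hg hbig
    · push Not at hbig
      exact J_four_nonneg_of_ten_le hs hG hr (fun P hP => by have := hbig P hP; omega) hg

/-- **The big-plane clause from its three pieces** (the trichotomy of §21.18.1: generic / a plane trace of `g − 1`
or `g − 2` points / plane-line with every plane trace `≤ g − 3`; «plane + one point» is
`J_four_nonneg_of_plane_add_one`). -/
theorem bigPlaneClause_of (hα : GenericFourBig) (hβ : PlaneAddTwoFour) (hγ : PlaneLineFourBig) :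
    BigPlaneClause := by
  intro β _ M _ G hs hG hr hg hbig
  by_cases hgen : Generic M G
  · exact hα M G hs hG hr hgen hg hbig
  by_cases hβc : ∃ P ∈ planes M, G.card ≤ (P ∩ G).card + 2
  · obtain ⟨P, hP, hPc⟩ := hβc
    have hlt : (P ∩ G).card < G.card := by
      apply Finset.card_lt_card
      refine ⟨Finset.inter_subset_right, fun h => not_subset_plane hr hP ?_⟩
      intro z hz
      exact (Finset.mem_inter.1 (h hz)).1
    rcases (show (P ∩ G).card + 1 = G.card ∨ (P ∩ G).card + 2 = G.card by omega) with h1 | h2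
    · exact J_four_nonneg_of_plane_add_one hP h1
    · exact hβ M G hs hG hr P hP h2 hg
  · push Not at hβc
    exact hγ M G hs hG hr hgen (fun P hP => by have := hβc P hP; omega) hg hbig

/-- **Theorem 22′ from its three pieces.** -/
theorem twentyTwoPrime_of (hα : GenericFour) (hβ : PlaneAddTwoFour) (hγ : PlaneLineFour) : TwentyTwoPrime :=
  twentyTwoPrime_iff_bigPlane.2
    (bigPlaneClause_of (genericFour_iff_big.1 hα) hβ (planeLineFour_iff_big.1 hγ))

/-- **`SixFourResidue` from the type-`3` clause and the three big-plane pieces.** -/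
theorem sixFourResidue_of_big_pieces (h3 : TypeThreeClause) (hα : GenericFourBig) (hβ : PlaneAddTwoFour)
    (hγ : PlaneLineFourBig) : SixFourResidue :=
  sixFourResidue_of_two_clauses h3 (bigPlaneClause_of hα hβ hγ)

/-- **C-025 at `(6, 4)` on every finite matroid from the type-`3` clause and the three big-plane pieces**:
`RLS M 6 4`. -/
theorem rls_six_four_of_big_pieces {α : Type} (h3 : TypeThreeClause) (hα : GenericFourBig) (hβ : PlaneAddTwoFour)
    (hγ : PlaneLineFourBig) (M : Matroid α) [M.Finite] : RLS M 6 4 :=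
  rls_six_four_of_residue (sixFourResidue_of_big_pieces h3 hα hβ hγ) M

end PercRepro.SixFour
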